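import Summits.QuantumFields.YangMills.Theorems.UnitScaleTiltProp8ChartHInvSmoothBump
import HarnessLib

/-!
# Route `UnitScaleTilt`, crux K1 «MinimiserStabilityRegPr» (stmt-QuantumFields-19200), leaf V2′ — the P2→P3 BRIDGE (hH of `ChartRemainderAt`),
# part B2′(ii): **C^{1,1} TENTS ON THE `j`-FOLD BLOCKS WITH THE SECOND-DIFFERENCE ROW `64/L^{2j}`** (WANTED №g26-1 (X3′), OWNER RULINGS g26 04:53:50Z ∕ 05:27:07Z:
# filed as `…SmoothTent64` beside ★w3-19200 g4's ✓ p607264 `…ChartHInvSmoothTent` (same bump, crude constant `256/L^{2j}`); ✓ p606699 `…ChartHInvGradLetter` consumes the `64` row verbatim)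

Cell `ym3-torus`, width seat `ym-ust-19200-w5` gen 3 (count-neutral helper; `--supports stmt-QuantumFields-19200 --as helper`; def-free, 0 sorry).

WHY.  Part B2 (`ChartHInvTent.exists_tent`, p1 g18) spreads the pinned comb values of the bridge `H X = H₀X̃′ + dφ` by PIECEWISE-LINEAR pyramids
`1 − (2/(N+1))|o − c|` (kink on the centre hyperplanes: second difference `−4/(N+1)` = first-difference order), so the chart-`H` of record has the (46) SUP row but
NO k-uniform (46) GRADIENT row (`w 2 b·L^{K−n}·‖HX(b+e_ν) − HX(b)‖`, the second letter of F4's currency — LOCATED ✗ (X3), seat w5 g3 04:51Z, owner-accepted).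
THIS FILE supplies tents with the SAME identity∕support∕range clauses and BOTH difference rows: the product over the coordinates of the quartic bump
`G(u) = (4u(1−u))²` read at the in-block labels `u_o = (o + ½)/N`, `N = L^j` — `G(½) = 1` at the centre label `c = (N−1)/2` (N odd), `G ≤ 16u²`, `G ≤ 16(1−u)²`
(so `≤ 4/N²` at the two face labels, `≤ 36/N²` at the next ones), `|G(a) − G(b)| ≤ 8|a − b|` and `G(u+2h) − 2G(u+h) + G(u) = 16h²(12(u+h−½)² − 1 + 2h²)`
(exact algebra) — hence slope `8/L^j` and second differences `≤ 64/L^{2j}` on EVERY pair of fine steps, including the steps across a block face (where the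
tent drops from `≤ 36/N²` to `0`).  MECHANISM: the tent is a product of ONE-COORDINATE functions `h_μ(x_μ) = [x_μ.val / N = y_μ.val]·G(u_{x_μ.val % N})` on
`ZMod (sitesPerDir 0)` (the block indicator folds into the factors, `val_iterBlockOf`), so both rows FACTORISE (`Δ_μΔ_ντ = Δh_μ·Δh_ν·Π` for `μ ≠ ν`,
`Δ_μ²τ = Δ²h_μ·Π`) and every case (interior ∕ face ∕ wrap) is one-dimensional (`z ↦ z + 1` on `ZMod M`, `N ∣ M`).

WHAT THIS FILE PROVES (no definition; the tent lives inside the `∃`; the bump and its one-coordinate factor are part B2′(i) `…ChartHInvSmoothBump`: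
`abs_coordFn_step_le` (`≤ 8/N`), `abs_coordFn_step2_le` (`≤ 64/N²`)):
* product bookkeeping `prod_coord_eq`, `prod_coord_shift_eq`, `prod_erase_coord_eq`, `prod_erase_coord_shift_eq`;
* **`exists_smoothTent64`** — for `j ≤ m + K`, `y ∈ T^{(j)}`: `∃ τ : T_η → [0,1]`, `τ(embIter j y) = 1`, `τ = 0` off `B^j(y)`, `|τ(b₊) − τ(b₋)| ≤ 8/L^j`,
  and `|τ(x+e_ν+e_μ) − τ(x+e_ν) − τ(x+e_μ) + τ(x)| ≤ 64/(L^j)²` for all `x, μ, ν` — the shape of `exists_tent` with the slope constant `2 → 8` and ONE extra clause.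
HONEST SCOPE: lattice calculus only; the gradient row of the bridge built on these tents is part C2′ (`…ChartHInvGradLetter`).  NOT a claim about the mass gap.

References: T. Bałaban, CMP **102** (1985) 277–309 [Balaban1985Variational] ((46) p.285, (152) p.301); CMP **96** (1984) 223–250 [Balaban1984PropagatorsII]
((2.147) p.248); CMP **109** (1987) 249–301 [Balaban1987RG1] ((0.1) pp.251–252).
-/

set_option autoImplicit false

noncomputable section

open scoped BigOperators

namespace Summit.QuantumFields.YangMills.Theorems.ChartHInv

open Literature.MathematicalPhysics.QuantumFieldTheory.Balaban1983to89
open B5Eq118OneStroke (iterBlockOf val_iterBlockOf)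
open B15DeterminingSets (embIter)
open Literature.MathematicalPhysics.QuantumFieldTheory.BalabanImbrieJaffe1984to88.BIJ88RT51Background (iterBlockOf_embIter)
open Literature.MathematicalPhysics.QuantumFieldTheory.BalabanImbrieJaffe1984to88 (BIJ88BlockCentredWeight.pow_dvd_sitesPerDir)

/-! ## §3 The smooth tent on the `j`-fold blocks -/

section Tent

variable {P : Params}

/-- product bookkeeping: single out one coordinate. [folklore] -/
theorem prod_coord_eq (f : Fin P.d → ZMod (P.sitesPerDir 0) → ℝ) (w : Site P 0) (μ : Fin P.d) :
    ∏ κ, f κ (w κ) = f μ (w μ) * ∏ κ ∈ Finset.univ.erase μ, f κ (w κ) :=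
  (Finset.mul_prod_erase _ _ (Finset.mem_univ μ)).symm

/-- product bookkeeping: the shifted site differs in one coordinate. [folklore] -/
theorem prod_coord_shift_eq (f : Fin P.d → ZMod (P.sitesPerDir 0) → ℝ) (w : Site P 0) (μ : Fin P.d) :
    ∏ κ, f κ ((w.shift μ) κ) = f μ (w μ + 1) * ∏ κ ∈ Finset.univ.erase μ, f κ (w κ) := by
  rw [prod_coord_eq f (w.shift μ) μ]
  congr 1
  · simp only [Site.shift, Function.update_self]
  · refine Finset.prod_congr rfl fun κ hκ => ?_
    simp only [Site.shift, Function.update_of_ne (Finset.ne_of_mem_erase hκ)]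

/-- product bookkeeping: two distinct coordinates singled out. [folklore] -/
theorem prod_erase_coord_eq (f : Fin P.d → ZMod (P.sitesPerDir 0) → ℝ) (w : Site P 0) {μ ν : Fin P.d} (hμν : μ ≠ ν) :
    ∏ κ ∈ Finset.univ.erase μ, f κ (w κ) = f ν (w ν) * ∏ κ ∈ (Finset.univ.erase μ).erase ν, f κ (w κ) :=
  (Finset.mul_prod_erase _ _ (Finset.mem_erase.2 ⟨hμν.symm, Finset.mem_univ ν⟩)).symm

/-- product bookkeeping: two distinct coordinates, the second one shifted. [folklore] -/
theorem prod_erase_coord_shift_eq (f : Fin P.d → ZMod (P.sitesPerDir 0) → ℝ) (w : Site P 0) {μ ν : Fin P.d} (hμν : μ ≠ ν) :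
    ∏ κ ∈ Finset.univ.erase μ, f κ ((w.shift ν) κ) = f ν (w ν + 1) * ∏ κ ∈ (Finset.univ.erase μ).erase ν, f κ (w κ) := by
  rw [prod_erase_coord_eq f (w.shift ν) hμν]
  congr 1
  · simp only [Site.shift, Function.update_self]
  · refine Finset.prod_congr rfl fun κ hκ => ?_
    simp only [Site.shift, Function.update_of_ne (Finset.ne_of_mem_erase hκ)]

/-- **SMOOTH TENTS**: for every `j ≤ m + K` and `y ∈ T^{(j)}` there is `τ : T_η → [0, 1]` with `τ(embIter j y) = 1`, `τ = 0` off `B^j(y)`,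
`|τ(b₊) − τ(b₋)| ≤ 8/L^j` on every fine bond, AND `|τ(x+e_ν+e_μ) − τ(x+e_ν) − τ(x+e_μ) + τ(x)| ≤ 64/L^{2j}` for all `x, μ, ν` (the product over the coordinates of the
quartic bumps `(4u(1−u))²` in the in-block labels `u = (o + ½)/L^j`; the rows factorise over the coordinates).  Same identity∕support∕range clauses as
`exists_tent`, slope constant `8` instead of `2`, one extra clause. [cite: Balaban1984PropagatorsII, (2.147) p.248; Balaban1985Variational, (46) p.285] -/
theorem exists_smoothTent64 {j : ℕ} (hj : j ≤ P.m + P.K) (y : Site P j) :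
    ∃ τ : Site P 0 → ℝ, τ (embIter j y) = 1 ∧ (∀ x, iterBlockOf j x ≠ y → τ x = 0) ∧ (∀ x, 0 ≤ τ x ∧ τ x ≤ 1) ∧
      (∀ b : PBond P 0, |τ b.tgt - τ b.src| ≤ 8 / (P.L : ℝ) ^ j) ∧
      ∀ (x : Site P 0) (μ ν : Fin P.d), |τ ((x.shift ν).shift μ) - τ (x.shift ν) - τ (x.shift μ) + τ x| ≤ 64 / ((P.L : ℝ) ^ j) ^ 2 := by
  classical
  obtain ⟨c, hc⟩ : Odd (P.L ^ j) := P.hL.1.pow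
  set N : ℕ := P.L ^ j with hN
  have hNpos : 0 < N := pow_pos P.L_pos j
  have hNM : N ∣ P.sitesPerDir 0 := BIJ88BlockCentredWeight.pow_dvd_sitesPerDir hj
  have hNr : ((N : ℕ) : ℝ) = (P.L : ℝ) ^ j := by rw [hN]; push_cast; rfl
  -- the one-coordinate factors
  obtain ⟨f, hf⟩ : ∃ f : Fin P.d → ZMod (P.sitesPerDir 0) → ℝ, ∀ μ z, f μ z =
      if z.val / N = (y μ).val then (4 * ((((z.val % N : ℕ) : ℝ) + 1 / 2) / N) * (1 - (((z.val % N : ℕ) : ℝ) + 1 / 2) / N)) ^ 2 else 0 :=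
    ⟨_, fun _ _ => rfl⟩
  have hf01 : ∀ μ z, 0 ≤ f μ z ∧ f μ z ≤ 1 := fun μ z => coordFn_mem_unit N hNpos (y μ).val (f μ) (hf μ) z
  have hstep : ∀ μ z, |f μ (z + 1) - f μ z| ≤ 8 / (N : ℝ) := fun μ z => abs_coordFn_step_le hNpos hNM (y μ).val (f μ) (hf μ) z
  have hstep2 : ∀ μ z, |f μ (z + 1 + 1) - 2 * f μ (z + 1) + f μ z| ≤ 64 / (N : ℝ) ^ 2 := fun μ z =>
    abs_coordFn_step2_le hNpos hNM (y μ).val (f μ) (hf μ) z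
  have hprod01 : ∀ (s : Finset (Fin P.d)) (w : Site P 0), 0 ≤ ∏ κ ∈ s, f κ (w κ) ∧ ∏ κ ∈ s, f κ (w κ) ≤ 1 :=
    fun s w => prod_mem_unit s _ fun κ _ => hf01 κ (w κ)
  refine ⟨fun x => ∏ μ, f μ (x μ), ?_, ?_, fun x => hprod01 _ x, ?_, ?_⟩
  · -- the centre: every factor is the bump at `u = ½`
    refine Finset.prod_eq_one fun μ _ => ?_
    have hdiv : ((embIter j y) μ).val / N = (y μ).val := by
      rw [hN, ← val_iterBlockOf j hj (embIter j y) μ, iterBlockOf_embIter j hj y]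
    have hmod : ((embIter j y) μ).val % N = (N - 1) / 2 := by rw [hN]; exact val_embIter_mod hj y μ
    rw [hf, if_pos hdiv, hmod]
    have hcN : (N - 1) / 2 = c := by omega
    have hNne : ((N : ℕ) : ℝ) ≠ 0 := by exact_mod_cast hNpos.ne'
    have hu : ((((N - 1) / 2 : ℕ) : ℝ) + 1 / 2) / N = 1 / 2 := by
      rw [hcN, div_eq_iff hNne, hc]; push_cast; ring
    rw [hu]; norm_num
  · -- off the block one factor vanishes
    intro x hx
    obtain ⟨μ, hμ⟩ : ∃ μ, iterBlockOf j x μ ≠ y μ := Function.ne_iff.mp hx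
    refine Finset.prod_eq_zero (Finset.mem_univ μ) ?_
    rw [hf, if_neg]
    intro hdiv
    apply hμ
    apply ZMod.val_injective
    rw [val_iterBlockOf j hj, ← hN, hdiv]
  · -- first differences along a fine bond `b = ⟨x, ν⟩`, `b₊ = x + e_ν`
    intro b
    beta_reduce
    have htgt : b.tgt = b.src.shift b.dir := rfl
    rw [htgt, prod_coord_shift_eq f b.src b.dir, prod_coord_eq f b.src b.dir, ← sub_mul, abs_mul,
      abs_of_nonneg (hprod01 _ b.src).1, ← hNr]
    calc |f b.dir (b.src b.dir + 1) - f b.dir (b.src b.dir)| * ∏ κ ∈ Finset.univ.erase b.dir, f κ (b.src κ)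
        ≤ 8 / (N : ℝ) * 1 := mul_le_mul (hstep _ _) (hprod01 _ b.src).2 (hprod01 _ b.src).1 (by positivity)
      _ = 8 / (N : ℝ) := mul_one _
  · -- second differences
    intro x μ ν
    beta_reduce
    rw [← hNr]
    by_cases hμν : μ = ν
    · subst hμν
      -- the same coordinate twice
      have h2 : ∏ κ, f κ (((x.shift μ).shift μ) κ) = f μ (x μ + 1 + 1) * ∏ κ ∈ Finset.univ.erase μ, f κ (x κ) := by
        rw [prod_coord_shift_eq f (x.shift μ) μ]
        congr 1
        · simp only [Site.shift, Function.update_self]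
        · refine Finset.prod_congr rfl fun κ hκ => ?_
          simp only [Site.shift, Function.update_of_ne (Finset.ne_of_mem_erase hκ)]
      rw [h2, prod_coord_shift_eq f x μ, prod_coord_eq f x μ]
      rw [show f μ (x μ + 1 + 1) * ∏ κ ∈ Finset.univ.erase μ, f κ (x κ) - f μ (x μ + 1) * ∏ κ ∈ Finset.univ.erase μ, f κ (x κ) -
          f μ (x μ + 1) * ∏ κ ∈ Finset.univ.erase μ, f κ (x κ) + f μ (x μ) * ∏ κ ∈ Finset.univ.erase μ, f κ (x κ) =
          (f μ (x μ + 1 + 1) - 2 * f μ (x μ + 1) + f μ (x μ)) * ∏ κ ∈ Finset.univ.erase μ, f κ (x κ) by ring,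
        abs_mul, abs_of_nonneg (hprod01 _ x).1]
      calc |f μ (x μ + 1 + 1) - 2 * f μ (x μ + 1) + f μ (x μ)| * ∏ κ ∈ Finset.univ.erase μ, f κ (x κ)
          ≤ 64 / (N : ℝ) ^ 2 * 1 := mul_le_mul (hstep2 _ _) (hprod01 _ x).2 (hprod01 _ x).1 (by positivity)
        _ = 64 / (N : ℝ) ^ 2 := mul_one _
    · -- two distinct coordinates: the mixed difference factorises
      have hA : ∏ κ, f κ (((x.shift ν).shift μ) κ) = f μ (x μ + 1) * (f ν (x ν + 1) * ∏ κ ∈ (Finset.univ.erase μ).erase ν, f κ (x κ)) := by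
        rw [prod_coord_shift_eq f (x.shift ν) μ, prod_erase_coord_shift_eq f x hμν]
        congr 1
        simp only [Site.shift, Function.update_of_ne hμν]
      have hB : ∏ κ, f κ ((x.shift ν) κ) = f μ (x μ) * (f ν (x ν + 1) * ∏ κ ∈ (Finset.univ.erase μ).erase ν, f κ (x κ)) := by
        rw [prod_coord_eq f (x.shift ν) μ, prod_erase_coord_shift_eq f x hμν]
        congr 1
        simp only [Site.shift, Function.update_of_ne hμν]
      have hC : ∏ κ, f κ ((x.shift μ) κ) = f μ (x μ + 1) * (f ν (x ν) * ∏ κ ∈ (Finset.univ.erase μ).erase ν, f κ (x κ)) := by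
        rw [prod_coord_shift_eq f x μ, prod_erase_coord_eq f x hμν]
      have hD : ∏ κ, f κ (x κ) = f μ (x μ) * (f ν (x ν) * ∏ κ ∈ (Finset.univ.erase μ).erase ν, f κ (x κ)) := by
        rw [prod_coord_eq f x μ, prod_erase_coord_eq f x hμν]
      rw [hA, hB, hC, hD]
      rw [show f μ (x μ + 1) * (f ν (x ν + 1) * ∏ κ ∈ (Finset.univ.erase μ).erase ν, f κ (x κ)) -
            f μ (x μ) * (f ν (x ν + 1) * ∏ κ ∈ (Finset.univ.erase μ).erase ν, f κ (x κ)) -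
            f μ (x μ + 1) * (f ν (x ν) * ∏ κ ∈ (Finset.univ.erase μ).erase ν, f κ (x κ)) +
            f μ (x μ) * (f ν (x ν) * ∏ κ ∈ (Finset.univ.erase μ).erase ν, f κ (x κ)) =
          ((f μ (x μ + 1) - f μ (x μ)) * (f ν (x ν + 1) - f ν (x ν))) * ∏ κ ∈ (Finset.univ.erase μ).erase ν, f κ (x κ) by ring,
        abs_mul, abs_mul, abs_of_nonneg (hprod01 _ x).1]
      have h8 : 0 ≤ 8 / (N : ℝ) := by positivity
      calc |f μ (x μ + 1) - f μ (x μ)| * |f ν (x ν + 1) - f ν (x ν)| * ∏ κ ∈ (Finset.univ.erase μ).erase ν, f κ (x κ)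
          ≤ 8 / (N : ℝ) * (8 / (N : ℝ)) * 1 :=
            mul_le_mul (mul_le_mul (hstep _ _) (hstep _ _) (abs_nonneg _) h8) (hprod01 _ x).2 (hprod01 _ x).1 (by positivity)
        _ = 64 / (N : ℝ) ^ 2 := by ring

end Tent

end Summit.QuantumFields.YangMills.Theorems.ChartHInv

end
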